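import Literature.Analysis.FluidPDE.PoissonSliceGradient
import Literature.Analysis.FluidPDE.LaplaceDivFormRoundOne
import Literature.Analysis.FluidPDE.NSBoundedSpatialHolderProofs
import HarnessLib

/-!
# The elliptic slice step of the Serrin bootstrap, with constants

Analysis/FluidPDE file (sequel to `PoissonSliceGradient`). In the bootstrap for bounded
distributional Navier–Stokes solutions (Serrin 1962; Lemarié-Rieusset 2016, Thm. 13.1) the
derivatives `∂^{β}u_b`, `β = eᵢ :: γ`, of the velocity are improved *at fixed times* by elliptic
theory for the very weak Poisson equation `Δ(∂^γu_b) = Σ_c ∂_c(∂^γA_{cb})`, while the time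
integrability is inherited from the vorticity side. This file proves the two space–time
statements used by the induction, with constants fixed before the solution:

* `eLpNorm_partial_le_of_poisson_pair` (`2 ≤ m ≤ 6`): if `v, F_c ∈ L^∞(Q)` (`Q = ]-L,0[ × B_R`,
  bound `K`) solve `∫ vΔψ = -Σ∫F_c∂_cψ`, and `v' ∈ L²(Q₁)`, `F'_c ∈ L^m(Q₁)` (`Q₁ = ]-L,0[ × B_{R₁}`)
  represent `∂ᵢv`, resp. solve `∫ v'Δψ = -Σ∫F'_c∂_cψ`, then
  `‖v'‖_{L^m(]-L,0[ × B_ρ)} ≤ C (K + Σ_c ‖F'_c‖_{L^m(Q₁)})`: at a.e. time the slice `v'(t)` is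
  the weak derivative of `v(t)`, whose `L²` norm is bounded by the level-`γ` data
  (`LaplaceVeryWeak.exists_weakGrad_of_veryWeak`), it is `W^{1,2}` with the gradient-form
  equation (same theorem at the next level), hence in `L⁶` with the bound
  (`LaplaceDivFormRoundOne.exists_eLpNorm_six_le`); Tonelli and Minkowski integrate in time.
* `ae_abs_partial_le_of_poisson_pair` (`m = ∞`): the same with the De Giorgi–Nash–Moser sup
  bound (`LaplaceDivFormInteriorHolder_holds`, `q = ∞`) gives an a.e. bound of `v'`.

## References

* J. Serrin, Arch. Rational Mech. Anal. 9 (1962) 187–195. [folklore]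
* D. Gilbarg, N. Trudinger, *Elliptic PDE of Second Order* (2001), §8.3, Thm. 8.24.
  [`GilbargTrudinger2001`]
* P. G. Lemarié-Rieusset, *The Navier–Stokes Problem in the 21st Century* (2016), Thm. 13.1.
  [`LemarieRieusset2016`]
-/

noncomputable section

open MeasureTheory Set Function Filter Topology TopologicalSpace Metric
open scoped NNReal ENNReal

namespace Literature.Analysis.FluidPDE

namespace RepDeriv

open Literature.Analysis.FunctionSpaces
open scoped Laplacian RealInnerProductSpace

/-! ### Slices of `L^p` functions on products, general exponent -/

section SliceLp

variable {X Y : Type*} [MeasurableSpace X] [MeasurableSpace Y] {μ : Measure X} {ν : Measure Y}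
  [SFinite μ] [SFinite ν]

/-- Almost every slice of an `L^p` function on a product is in `L^p` (`0 < p < ∞`). [folklore] -/
theorem ae_memLp_slice {p : ℝ≥0∞} (hp0 : p ≠ 0) (hpt : p ≠ ∞) {U : X × Y → ℝ}
    (hU : MemLp U p (μ.prod ν)) : ∀ᵐ t ∂μ, MemLp (fun x => U (t, x)) p ν := by
  have hi := (integrable_norm_rpow_iff hU.1 hp0 hpt).2 hU
  filter_upwards [hi.prod_right_ae, hU.1.prodMk_left] with t ht hm
  exact (integrable_norm_rpow_iff hm hp0 hpt).1 ht

omit [SFinite μ] [SFinite ν] in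
/-- `‖f‖_{L^p}^p = ∫ ‖f‖ₑ^p` (`0 < p < ∞`). [folklore] -/
theorem eLpNorm_rpow_eq_lintegral {α : Type*} [MeasurableSpace α] {μ' : Measure α} {p : ℝ≥0∞}
    (hp0 : p ≠ 0) (hpt : p ≠ ∞) (f : α → ℝ) :
    eLpNorm f p μ' ^ p.toReal = ∫⁻ x, ‖f x‖ₑ ^ p.toReal ∂μ' := by
  lift p to ℝ≥0 using hpt
  have hp : p ≠ 0 := fun h => hp0 (by simp [h])
  simpa using eLpNorm_nnreal_pow_eq_lintegral (μ := μ') (f := f) hp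

omit [SFinite μ] in
/-- The `L^p` norms of the slices are a.e.-measurable (`0 < p < ∞`). [folklore] -/
theorem aemeasurable_eLpNorm_slice_gen {p : ℝ≥0∞} (hp0 : p ≠ 0) (hpt : p ≠ ∞) {U : X × Y → ℝ}
    (hU : AEStronglyMeasurable U (μ.prod ν)) :
    AEMeasurable (fun t => eLpNorm (fun x => U (t, x)) p ν) μ := by
  simp_rw [eLpNorm_eq_lintegral_rpow_enorm_toReal hp0 hpt]
  exact ((hU.enorm.pow_const _).lintegral_prod_right').pow_const _

omit [SFinite μ] in
/-- **Tonelli for `L^p` norms of slices** (`0 < p < ∞`):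
`(∫ ‖U(t, ·)‖^p_{L^p} dt)^{1/p} = ‖U‖_{L^p}`. [folklore] -/
theorem lintegral_eLpNorm_slice_rpow_gen {p : ℝ≥0∞} (hp0 : p ≠ 0) (hpt : p ≠ ∞) {U : X × Y → ℝ}
    (hU : AEStronglyMeasurable U (μ.prod ν)) :
    (∫⁻ t, eLpNorm (fun x => U (t, x)) p ν ^ p.toReal ∂μ) ^ (1 / p.toReal) =
      eLpNorm U p (μ.prod ν) := by
  simp_rw [eLpNorm_rpow_eq_lintegral hp0 hpt]
  rw [← lintegral_prod _ (hU.enorm.pow_const _), eLpNorm_eq_lintegral_rpow_enorm_toReal hp0 hpt]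

omit [SFinite μ] in
/-- The essential suprema of almost all slices are bounded by the essential supremum. [folklore] -/
theorem ae_eLpNorm_top_slice_le (U : X × Y → ℝ) :
    ∀ᵐ t ∂μ, eLpNorm (fun x => U (t, x)) ∞ ν ≤ eLpNorm U ∞ (μ.prod ν) := by
  have h := Measure.ae_ae_of_ae_prod (ae_le_eLpNormEssSup (f := U) (μ := μ.prod ν))
  filter_upwards [h] with t ht
  rw [eLpNorm_exponent_top, eLpNorm_exponent_top]
  exact eLpNormEssSup_le_of_ae_enorm_bound ht

omit [SFinite μ] in
/-- Almost all slices of a function essentially bounded on a product are essentially bounded by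
the same constant. [folklore] -/
theorem ae_slice_bound {U : X × Y → ℝ} {K : ℝ} (h : ∀ᵐ q ∂(μ.prod ν), |U q| ≤ K) :
    ∀ᵐ t ∂μ, ∀ᵐ x ∂ν, |U (t, x)| ≤ K :=
  Measure.ae_ae_of_ae_prod h

omit [SFinite μ] in
/-- **Integrating a slice bound in time** (Tonelli + Minkowski). If for a.e. `t`
`‖W(t, ·)‖_{L^p(ν)} ≤ A₀ + A₁ Σ_c ‖n_c(t, ·)‖_{L^p(ν₁)}` with `1 ≤ p < ∞`, then
`‖W‖_{L^p(μ × ν)} ≤ A₀ μ(X)^{1/p} + A₁ Σ_c ‖n_c‖_{L^p(μ × ν₁)}`. [folklore] -/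
theorem eLpNorm_prod_le_of_slice_bound {κ' : Type*} [Fintype κ'] {ν₁ : Measure Y} [SFinite ν₁]
    {p : ℝ≥0∞} (hp1 : 1 ≤ p) (hpt : p ≠ ∞) {W : X × Y → ℝ}
    (hW : AEStronglyMeasurable W (μ.prod ν)) {n : κ' → X × Y → ℝ}
    (hn : ∀ c, AEStronglyMeasurable (n c) (μ.prod ν₁)) {A₀ A₁ : ℝ≥0∞}
    (h : ∀ᵐ t ∂μ, eLpNorm (fun x => W (t, x)) p ν ≤
      A₀ + A₁ * ∑ c, eLpNorm (fun x => n c (t, x)) p ν₁) :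
    eLpNorm W p (μ.prod ν) ≤ A₀ * μ univ ^ (1 / p.toReal) + A₁ * ∑ c, eLpNorm (n c) p (μ.prod ν₁) := by
  have hp0 : p ≠ 0 := (zero_lt_one.trans_le hp1).ne'
  have hp' : 1 ≤ p.toReal := by
    rw [← ENNReal.toReal_one]
    exact (ENNReal.toReal_le_toReal ENNReal.one_ne_top hpt).2 hp1
  have hp'0 : 0 < p.toReal := zero_lt_one.trans_le hp'
  have hp'ne : p.toReal ≠ 0 := hp'0.ne'
  set sW : X → ℝ≥0∞ := fun t => eLpNorm (fun x => W (t, x)) p ν with hsW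
  set sn : κ' → X → ℝ≥0∞ := fun c t => eLpNorm (fun x => n c (t, x)) p ν₁ with hsn
  have hsW_m : AEMeasurable sW μ := aemeasurable_eLpNorm_slice_gen hp0 hpt hW
  have hsn_m : ∀ c, AEMeasurable (sn c) μ := fun c => aemeasurable_eLpNorm_slice_gen hp0 hpt (hn c)
  have hsum_m : AEMeasurable (fun t => ∑ c, sn c t) μ := Finset.aemeasurable_fun_sum _ fun c _ => hsn_m c
  -- Tonelli
  rw [← lintegral_eLpNorm_slice_rpow_gen hp0 hpt hW]
  -- monotonicity of the `L^p(dt)` functional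
  have step1 : (∫⁻ t, sW t ^ p.toReal ∂μ) ^ (1 / p.toReal) ≤
      (∫⁻ t, (A₀ + A₁ * ∑ c, sn c t) ^ p.toReal ∂μ) ^ (1 / p.toReal) := by
    refine ENNReal.rpow_le_rpow (lintegral_mono_ae ?_) (by positivity)
    filter_upwards [h] with t ht
    exact ENNReal.rpow_le_rpow ht (by positivity)
  -- Minkowski for the two summands
  have step2 := ENNReal.lintegral_Lp_add_le (μ := μ) (p := p.toReal) (f := fun _ => A₀)
    (g := fun t => A₁ * ∑ c, sn c t) aemeasurable_const (hsum_m.const_mul A₁) hp'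
  simp only [Pi.add_apply] at step2
  -- the constant term
  have e0 : (∫⁻ _ : X, A₀ ^ p.toReal ∂μ) ^ (1 / p.toReal) = A₀ * μ univ ^ (1 / p.toReal) := by
    rw [lintegral_const, ENNReal.mul_rpow_of_nonneg _ _ (by positivity), one_div,
      ENNReal.rpow_rpow_inv hp'ne]
  -- the sum term
  have e1 : (∫⁻ t, (A₁ * ∑ c, sn c t) ^ p.toReal ∂μ) ^ (1 / p.toReal) ≤
      A₁ * ∑ c, eLpNorm (n c) p (μ.prod ν₁) := by
    have h1 : (∫⁻ t, (A₁ * ∑ c, sn c t) ^ p.toReal ∂μ) ^ (1 / p.toReal) =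
        A₁ * (∫⁻ t, (∑ c, sn c t) ^ p.toReal ∂μ) ^ (1 / p.toReal) := by
      simp_rw [ENNReal.mul_rpow_of_nonneg _ _ hp'0.le]
      rw [lintegral_const_mul'' _ (hsum_m.pow_const _), ENNReal.mul_rpow_of_nonneg _ _ (by positivity),
        one_div, ENNReal.rpow_rpow_inv hp'ne]
    rw [h1]
    refine mul_le_mul' le_rfl ?_
    have h2 := lintegral_Lp_finset_sum_le (μ' := μ) hp' Finset.univ (f := sn) (fun c _ => hsn_m c)
    refine h2.trans (le_of_eq (Finset.sum_congr rfl fun c _ => ?_))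
    exact lintegral_eLpNorm_slice_rpow_gen hp0 hpt (hn c)
  calc (∫⁻ t, sW t ^ p.toReal ∂μ) ^ (1 / p.toReal)
      ≤ (∫⁻ t, (A₀ + A₁ * ∑ c, sn c t) ^ p.toReal ∂μ) ^ (1 / p.toReal) := step1
    _ ≤ (∫⁻ _ : X, A₀ ^ p.toReal ∂μ) ^ (1 / p.toReal) +
        (∫⁻ t, (A₁ * ∑ c, sn c t) ^ p.toReal ∂μ) ^ (1 / p.toReal) := step2
    _ ≤ A₀ * μ univ ^ (1 / p.toReal) + A₁ * ∑ c, eLpNorm (n c) p (μ.prod ν₁) := by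
        rw [e0]; exact add_le_add le_rfl e1

omit [SFinite μ] in
/-- From `∀ᵐ t, ∀ᵐ x` to `∀ᵐ (t, x)` for an enorm bound of an a.e. strongly measurable function.
[folklore] -/
theorem ae_prod_enorm_le_of_ae_ae {W : X × Y → ℝ} (hW : AEStronglyMeasurable W (μ.prod ν)) {b : ℝ≥0∞}
    (h : ∀ᵐ t ∂μ, ∀ᵐ x ∂ν, ‖W (t, x)‖ₑ ≤ b) : ∀ᵐ q ∂(μ.prod ν), ‖W q‖ₑ ≤ b := by
  have hmk := hW.ae_eq_mk
  have h1 : ∀ᵐ t ∂μ, ∀ᵐ x ∂ν, ‖hW.mk W (t, x)‖ₑ ≤ b := by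
    filter_upwards [h, Measure.ae_ae_of_ae_prod hmk] with t ht ht'
    filter_upwards [ht, ht'] with x hx hx'
    rwa [← hx']
  have hmeas : MeasurableSet {q : X × Y | ‖hW.mk W q‖ₑ ≤ b} :=
    measurableSet_le hW.stronglyMeasurable_mk.measurable.enorm measurable_const
  have h2 : ∀ᵐ q ∂(μ.prod ν), ‖hW.mk W q‖ₑ ≤ b := (Measure.ae_prod_iff_ae_ae hmeas).2 h1
  filter_upwards [h2, hmk] with q hq hq'
  rwa [hq']

end SliceLp

/-! ### Slicing: local integrability of slices, first-order identities, Poisson identities -/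

section SliceIds

variable {E : Type*} [NormedAddCommGroup E] [InnerProductSpace ℝ E] [FiniteDimensional ℝ E]
  [MeasurableSpace E] [BorelSpace E]

/-- Almost every slice of a function locally integrable on `(a, b) × Ω` is integrable on every
compact subset of `Ω`. [folklore] -/
theorem ae_integrableOn_slice_of_compact {a b : ℝ} {Ω : Opens E} {h : ℝ × E → ℝ}
    (hh : LocallyIntegrableOn h (Ioo a b ×ˢ (Ω : Set E)) volume) :
    ∀ᵐ t ∂(volume.restrict (Ioo a b)), ∀ k ⊆ (Ω : Set E), IsCompact k →
      IntegrableOn (fun x => h (t, x)) k volume := by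
  obtain ⟨K, hKc, hKΩ, hKabs⟩ := exists_compact_exhaustion_absorbing Ω
  set J : ℕ → Set ℝ := fun n => Icc (a + 1 / ((n : ℝ) + 1)) (b - 1 / ((n : ℝ) + 1)) with hJ
  have hJsub : ∀ n, J n ⊆ Ioo a b := by
    intro n t ht
    have hpos : (0 : ℝ) < 1 / ((n : ℝ) + 1) := Nat.one_div_pos_of_nat
    exact ⟨lt_of_lt_of_le (by linarith) ht.1, lt_of_le_of_lt ht.2 (by linarith)⟩
  have hJU : (⋃ n, J n) = Ioo a b := by
    refine subset_antisymm (iUnion_subset hJsub) fun t ht => ?_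
    obtain ⟨n, hn⟩ := exists_nat_one_div_lt (lt_min (sub_pos.2 ht.1) (sub_pos.2 ht.2))
    have h1 := min_le_left (t - a) (b - t)
    have h2 := min_le_right (t - a) (b - t)
    exact mem_iUnion.2 ⟨n, ⟨by linarith, by linarith⟩⟩
  have hint : ∀ᵐ t ∂(volume.restrict (Ioo a b)), ∀ n, IntegrableOn (fun x => h (t, x)) (K n) volume := by
    rw [← hJU, ae_restrict_iUnion_iff]
    intro l
    refine ae_all_iff.2 fun n => ?_
    have hC : IsCompact (J l ×ˢ K n) := isCompact_Icc.prod (hKc n)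
    have hCQ : J l ×ˢ K n ⊆ Ioo a b ×ˢ (Ω : Set E) := prod_mono (hJsub l) (hKΩ n)
    have hu := hh.integrableOn_compact_subset hCQ hC
    rw [IntegrableOn, Measure.volume_eq_prod, ← Measure.prod_restrict] at hu
    filter_upwards [hu.prod_right_ae] with t htu
    exact htu
  filter_upwards [hint] with t ht
  intro k hk hkc
  obtain ⟨n, hn⟩ := hKabs k hk hkc
  exact (ht n).mono_set hn

/-- **Slicing a first-order identity** `∫ v ∂ᵥψ = -∫ v' ψ` on `(a, b) × Ω`: for a.e. `t`,
`∫ v(t) ∂ᵥφ = -∫ v'(t) φ` for all `φ ∈ C_c^∞(Ω)`. [folklore] -/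
theorem ae_slice_firstOrder {a b : ℝ} {Ω : Opens E} {v v' : ℝ × E → ℝ} {w : E}
    (hv : LocallyIntegrableOn v (Ioo a b ×ˢ (Ω : Set E)) volume)
    (hv' : LocallyIntegrableOn v' (Ioo a b ×ˢ (Ω : Set E)) volume)
    (hid : ∀ ψ : ℝ → E → ℝ,
      IsSpaceTimeTestOn (⟨Ioo a b ×ˢ (Ω : Set E), isOpen_Ioo.prod Ω.isOpen⟩ : Opens (ℝ × E)) ψ →
        ∫ q : ℝ × E, v q * fderiv ℝ (ψ q.1) q.2 w = -∫ q : ℝ × E, v' q * ψ q.1 q.2) :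
    ∀ᵐ t ∂(volume.restrict (Ioo a b)), ∀ φ : E → ℝ, IsTestFunctionOn Ω φ →
      ∫ x, v (t, x) * fderiv ℝ φ x w = -∫ x, v' (t, x) * φ x := by
  set h : Bool → ℝ × E → ℝ := fun s => Bool.rec v' v s with hh
  set ds : Bool → List E := fun s => Bool.rec [] [w] s with hds
  have hhli : ∀ s, LocallyIntegrableOn (h s) (Ioo a b ×ˢ (Ω : Set E)) volume := by
    rintro (_ | _)
    · exact hv'
    · exact hv
  have hdsl : ∀ s, (ds s).length ≤ 2 := by rintro (_ | _) <;> simp [hds]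
  have hid' : ∀ ψ : ℝ → E → ℝ,
      IsSpaceTimeTestOn (⟨Ioo a b ×ˢ (Ω : Set E), isOpen_Ioo.prod Ω.isOpen⟩ : Opens (ℝ × E)) ψ →
        ∑ s, ∫ q : ℝ × E, h s q * derivs (ds s) ψ q.1 q.2 = 0 := by
    intro ψ hψ
    rw [Fintype.sum_bool]
    simp only [hh, hds, derivs_singleton, derivs_nil]
    rw [hid ψ hψ]
    ring
  filter_upwards [ae_slice_identity_sum hhli hdsl hid'] with t ht
  intro φ hφ
  have h0 := ht φ hφ
  rw [Fintype.sum_bool] at h0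
  simp only [hh, hds, sderivs_cons, sderivs_nil] at h0
  linarith

/-- **Slicing a very weak Poisson identity in divergence form** `∫ U Δψ = -Σ_c ∫ A_c ∂_{b_c}ψ`
on `(a, b) × Ω` (`b` an orthonormal basis): for a.e. `t` the sliced identity holds for all
`φ ∈ C_c^∞(Ω)`. [folklore] -/
theorem ae_slice_poisson {ι : Type*} [Fintype ι] (bs : OrthonormalBasis ι ℝ E) {a b : ℝ}
    {Ω : Opens E} {U : ℝ × E → ℝ} {A : ι → ℝ × E → ℝ}
    (hU : LocallyIntegrableOn U (Ioo a b ×ˢ (Ω : Set E)) volume)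
    (hA : ∀ c, LocallyIntegrableOn (A c) (Ioo a b ×ˢ (Ω : Set E)) volume)
    (hid : ∀ ψ : ℝ → E → ℝ,
      IsSpaceTimeTestOn (⟨Ioo a b ×ˢ (Ω : Set E), isOpen_Ioo.prod Ω.isOpen⟩ : Opens (ℝ × E)) ψ →
        ∫ q : ℝ × E, U q * (Δ (ψ q.1)) q.2 =
          -∑ c, ∫ q : ℝ × E, A c q * fderiv ℝ (ψ q.1) q.2 (bs c)) :
    ∀ᵐ t ∂(volume.restrict (Ioo a b)), ∀ φ : E → ℝ, IsTestFunctionOn Ω φ →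
      ∫ x, U (t, x) * (Δ φ) x = -∑ c, ∫ x, A c (t, x) * fderiv ℝ φ x (bs c) := by
  set Qo : Opens (ℝ × E) := ⟨Ioo a b ×ˢ (Ω : Set E), isOpen_Ioo.prod Ω.isOpen⟩ with hQo
  set h : ι ⊕ ι → ℝ × E → ℝ := fun m => Sum.elim (fun _ => U) A m with hh
  set ds : ι ⊕ ι → List E := fun m => Sum.elim (fun j => [bs j, bs j]) (fun c => [bs c]) m with hds
  have hhli : ∀ m, LocallyIntegrableOn (h m) (Ioo a b ×ˢ (Ω : Set E)) volume := by
    rintro (j | c)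
    · exact hU
    · exact hA c
  have hdsl : ∀ m, (ds m).length ≤ 2 := by
    rintro (j | c) <;> simp [hds]
  have hlapψ : ∀ {ψ : ℝ → E → ℝ}, IsSpaceTimeTestOn Qo ψ → ∀ q : ℝ × E,
      (Δ (ψ q.1)) q.2 = ∑ j, derivs [bs j, bs j] ψ q.1 q.2 := by
    intro ψ hψ q
    have h2 : ContDiff ℝ 2 (ψ q.1) := (hψ.contDiff_slice q.1).of_le (by norm_cast)
    rw [laplacian_eq_sum_fderiv_fderiv_normed bs h2]
    rfl
  have hid' : ∀ ψ : ℝ → E → ℝ, IsSpaceTimeTestOn Qo ψ →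
      ∑ m, ∫ q : ℝ × E, h m q * derivs (ds m) ψ q.1 q.2 = 0 := by
    intro ψ hψ
    rw [Fintype.sum_sum_type]
    simp only [hh, hds, Sum.elim_inl, Sum.elim_inr]
    have hlap : ∑ j, ∫ q : ℝ × E, U q * derivs [bs j, bs j] ψ q.1 q.2 =
        ∫ q : ℝ × E, U q * (Δ (ψ q.1)) q.2 := by
      rw [← integral_finsetSum _ fun j _ => (isRepDeriv_nil hU).integrable_mul' (hψ.derivs _)]
      refine integral_congr_ae (Eventually.of_forall fun q => ?_)
      dsimp only
      rw [← Finset.mul_sum, hlapψ hψ q]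
    have hfirst : ∀ c, ∫ q : ℝ × E, A c q * derivs [bs c] ψ q.1 q.2 =
        ∫ q : ℝ × E, A c q * fderiv ℝ (ψ q.1) q.2 (bs c) := fun c => rfl
    rw [hlap, hid ψ hψ]
    simp_rw [hfirst]
    ring
  filter_upwards [ae_slice_identity_sum hhli hdsl hid', ae_integrableOn_slice_of_compact hU]
    with t ht hUt
  intro φ hφ
  have h0 := ht φ hφ
  rw [Fintype.sum_sum_type] at h0
  simp only [hh, hds, Sum.elim_inl, Sum.elim_inr] at h0
  have hUt_int : IntegrableOn (fun x => U (t, x)) (tsupport φ) volume :=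
    hUt _ hφ.tsupport_subset hφ.hasCompactSupport
  have hlap : ∑ j, ∫ x, U (t, x) * sderivs [bs j, bs j] φ x = ∫ x, U (t, x) * (Δ φ) x := by
    have hint : ∀ j, Integrable (fun x => U (t, x) * sderivs [bs j, bs j] φ x)
        (volume : Measure E) := by
      intro j
      have := integrable_mul_of_eq_zero_off_compact hφ.hasCompactSupport
        (contDiff_sderivs [bs j, bs j] hφ.contDiff).continuous
        (fun x hx => sderivs_eq_zero_of_notMem_tsupport [bs j, bs j] hx) hUt_int
      simpa only [mul_comm] using this
    rw [← integral_finsetSum _ fun j _ => hint j]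
    refine integral_congr_ae (Eventually.of_forall fun x => ?_)
    dsimp only
    rw [← Finset.mul_sum, laplacian_eq_sum_fderiv_fderiv_normed bs (hφ.contDiff.of_le (by norm_cast))]
    rfl
  have hfirst : ∀ c, ∫ x, A c (t, x) * sderivs [bs c] φ x = ∫ x, A c (t, x) * fderiv ℝ φ x (bs c) :=
    fun c => rfl
  rw [hlap] at h0
  simp_rw [hfirst] at h0
  linarith

end SliceIds

/-! ### `ℝ³`: vector fields from components, and the vector form of sliced Poisson identities -/

section VectorForm

/-- The field with components `a_c ∈ L^q(S)` (`1 ≤ q`) is in `L^q(S)` with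
`‖(a_c)_c‖_{L^q} ≤ Σ_c ‖a_c‖_{L^q}`. [folklore] -/
theorem memLp_toLp_of_components {q : ℝ≥0∞} (hq : 1 ≤ q) {μ' : Measure (EuclideanSpace ℝ (Fin 3))}
    {a : Fin 3 → EuclideanSpace ℝ (Fin 3) → ℝ} (ha : ∀ c, MemLp (a c) q μ') :
    MemLp (fun x => (WithLp.toLp 2 (fun c => a c x) : EuclideanSpace ℝ (Fin 3))) q μ' ∧
      eLpNorm (fun x => (WithLp.toLp 2 (fun c => a c x) : EuclideanSpace ℝ (Fin 3))) q μ' ≤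
        ∑ c, eLpNorm (a c) q μ' := by
  set F : EuclideanSpace ℝ (Fin 3) → EuclideanSpace ℝ (Fin 3) :=
    fun x => WithLp.toLp 2 (fun c => a c x) with hF
  have hFmeas : AEStronglyMeasurable F μ' := by
    have h1 : AEMeasurable (fun x => fun c => a c x) μ' :=
      aemeasurable_pi_lambda _ fun c => (ha c).1.aemeasurable
    exact ((PiLp.continuous_toLp 2 (fun _ : Fin 3 => ℝ)).measurable.comp_aemeasurable h1).aestronglyMeasurable
  have hgL : MemLp (fun x => ∑ c, ‖a c x‖) q μ' := memLp_finsetSum _ fun c _ => (ha c).norm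
  have hFle : ∀ x, ‖F x‖ ≤ ‖∑ c, ‖a c x‖‖ := by
    intro x
    rw [Real.norm_of_nonneg (Finset.sum_nonneg fun c _ => norm_nonneg _)]
    simpa only [Real.norm_eq_abs] using norm_toLp_le_sum_abs fun c => a c x
  refine ⟨hgL.of_le hFmeas (Eventually.of_forall hFle), (eLpNorm_mono hFle).trans ?_⟩
  have hg_eq : (fun x => ∑ c, ‖a c x‖) = ∑ c, fun x => ‖a c x‖ := by
    funext x; simp [Finset.sum_apply]
  rw [hg_eq]
  refine (eLpNorm_sum_le (fun c _ => (ha c).1.norm) hq).trans (le_of_eq ?_)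
  exact Finset.sum_congr rfl fun c _ => eLpNorm_norm _

/-- **Vector form of a sliced Poisson identity on a ball**: from
`∫ f Δφ = -Σ_c ∫ a_c ∂_cφ` (whole-space integrals, `φ ∈ C_c^∞(B)`) to
`∫_B f Δφ = -∫_B ⟪(a_c)_c, ∇φ⟫`. [folklore] -/
theorem poisson_vector_form_of_slice {x₀ : EuclideanSpace ℝ (Fin 3)} {R : ℝ}
    {f : EuclideanSpace ℝ (Fin 3) → ℝ} {a : Fin 3 → EuclideanSpace ℝ (Fin 3) → ℝ}
    (ha : ∀ c, IntegrableOn (a c) (ball x₀ R) volume)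
    (hid : ∀ φ : EuclideanSpace ℝ (Fin 3) → ℝ,
      IsTestFunctionOn (⟨ball x₀ R, isOpen_ball⟩ : Opens (EuclideanSpace ℝ (Fin 3))) φ →
        ∫ x, f x * (Δ φ) x = -∑ c, ∫ x, a c x * fderiv ℝ φ x (EuclideanSpace.basisFun (Fin 3) ℝ c)) :
    ∀ φ : EuclideanSpace ℝ (Fin 3) → ℝ,
      IsTestFunctionOn (⟨ball x₀ R, isOpen_ball⟩ : Opens (EuclideanSpace ℝ (Fin 3))) φ →
        ∫ x in ball x₀ R, f x * (Δ φ) x =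
          -∫ x in ball x₀ R, ⟪(WithLp.toLp 2 (fun c => a c x) : EuclideanSpace ℝ (Fin 3)), gradient φ x⟫ := by
  intro φ hφ
  have h1 := hid φ hφ
  have hz1 : ∀ x ∉ ball x₀ R, f x * (Δ φ) x = 0 := by
    intro x hx
    have hx' : x ∉ tsupport φ := fun h' => hx (hφ.tsupport_subset h')
    rw [laplacian_eq_sum_sderivs (hφ.contDiff.of_le (by norm_cast))]
    simp [sderivs_eq_zero_of_notMem_tsupport _ hx']
  have hz2 : ∀ x ∉ ball x₀ R,
      ⟪(WithLp.toLp 2 (fun c => a c x) : EuclideanSpace ℝ (Fin 3)), gradient φ x⟫ = 0 := by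
    intro x hx
    have hx' : x ∉ tsupport φ := fun h' => hx (hφ.tsupport_subset h')
    have : fderiv ℝ φ x = 0 := fderiv_of_notMem_tsupport (𝕜 := ℝ) hx'
    simp [gradient, this]
  rw [setIntegral_eq_integral_of_forall_compl_eq_zero hz1,
    setIntegral_eq_integral_of_forall_compl_eq_zero hz2, h1]
  have hint : ∀ c, Integrable (fun x => a c x * fderiv ℝ φ x (EuclideanSpace.basisFun (Fin 3) ℝ c))
      (volume : Measure (EuclideanSpace ℝ (Fin 3))) := by
    intro c
    have hφ1 : Continuous fun x => fderiv ℝ φ x (EuclideanSpace.basisFun (Fin 3) ℝ c) :=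
      (hφ.contDiff.continuous_fderiv (by simp)).clm_apply continuous_const
    have := integrable_mul_of_eq_zero_off_compact hφ.hasCompactSupport hφ1
      (fun x hx => by simp [fderiv_of_notMem_tsupport (𝕜 := ℝ) hx])
      ((ha c).mono_set hφ.tsupport_subset)
    simpa only [mul_comm] using this
  rw [← integral_finsetSum _ fun c _ => hint c]
  congr 1
  refine integral_congr_ae (Eventually.of_forall fun x => ?_)
  dsimp only
  rw [inner_gradient_eq_sum_frame (EuclideanSpace.basisFun (Fin 3) ℝ) _ φ x]
  refine Finset.sum_congr rfl fun c _ => ?_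
  rw [EuclideanSpace.inner_basisFun_real]

/-- **Identification of slices**: a function `v₁` with `∫ v ∂ᵥφ = -∫ v₁ φ` for all test
functions on a ball, and a weak derivative `g` of `v` on that ball, satisfy `v₁ = g(v)` a.e. on
the ball (du Bois-Reymond). [folklore] -/
theorem ae_eq_weakDeriv_apply {x₀ : EuclideanSpace ℝ (Fin 3)} {r : ℝ}
    {v v₁ : EuclideanSpace ℝ (Fin 3) → ℝ} {g : EuclideanSpace ℝ (Fin 3) → EuclideanSpace ℝ (Fin 3) →L[ℝ] ℝ}
    {w : EuclideanSpace ℝ (Fin 3)}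
    (hg : HasWeakFDerivOn (⟨ball x₀ r, isOpen_ball⟩ : Opens (EuclideanSpace ℝ (Fin 3))) volume v g)
    (hv₁ : IntegrableOn v₁ (ball x₀ r) volume) (hgi : IntegrableOn g (ball x₀ r) volume)
    (hid : ∀ φ : EuclideanSpace ℝ (Fin 3) → ℝ,
      IsTestFunctionOn (⟨ball x₀ r, isOpen_ball⟩ : Opens (EuclideanSpace ℝ (Fin 3))) φ →
        ∫ x, v x * fderiv ℝ φ x w = -∫ x, v₁ x * φ x) :
    ∀ᵐ x ∂(volume : Measure (EuclideanSpace ℝ (Fin 3))), x ∈ ball x₀ r → v₁ x = g x w := by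
  have hloc : LocallyIntegrableOn (fun x => v₁ x - g x w) (ball x₀ r) volume :=
    (hv₁.sub ((ContinuousLinearMap.apply ℝ ℝ w).integrable_comp hgi)).locallyIntegrableOn
  have h := (isOpen_ball (x := x₀) (ε := r)).ae_eq_zero_of_integral_contDiff_smul_eq_zero hloc ?_
  · filter_upwards [h] with x hx hxB
    exact sub_eq_zero.1 (hx hxB)
  intro φ hφs hφc hφsupp
  have hφ : IsTestFunctionOn (⟨ball x₀ r, isOpen_ball⟩ : Opens (EuclideanSpace ℝ (Fin 3))) φ :=
    ⟨hφs, hφc, hφsupp⟩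
  have h1 := hid φ hφ
  have h2 := hg.integral_fderiv_smul_eq φ w hφ
  -- whole-space forms of the set integrals in `h2`
  have hz1 : ∀ x ∉ ball x₀ r, (fderiv ℝ φ x w) • v x = 0 := by
    intro x hx
    have hx' : x ∉ tsupport φ := fun h' => hx (hφ.tsupport_subset h')
    simp [fderiv_of_notMem_tsupport (𝕜 := ℝ) hx']
  have hz2 : ∀ x ∉ ball x₀ r, φ x • g x w = 0 := by
    intro x hx
    have hx' : x ∉ tsupport φ := fun h' => hx (hφ.tsupport_subset h')
    simp [image_eq_zero_of_notMem_tsupport hx']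
  have h2' : ∫ x, (fderiv ℝ φ x w) • v x = -∫ x, φ x • g x w := by
    rw [← setIntegral_eq_integral_of_forall_compl_eq_zero hz1,
      ← setIntegral_eq_integral_of_forall_compl_eq_zero hz2]
    exact h2
  simp only [smul_eq_mul] at h2' ⊢
  have e1 : ∫ x, fderiv ℝ φ x w * v x = ∫ x, v x * fderiv ℝ φ x w :=
    integral_congr_ae (Eventually.of_forall fun x => mul_comm _ _)
  rw [e1, h1] at h2'
  -- `∫ φ (v₁ - g w) = ∫ φ v₁ - ∫ φ (g w)`
  have hφc' : Continuous φ := hφs.continuous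
  have i1 : Integrable (fun x => φ x * v₁ x) (volume : Measure (EuclideanSpace ℝ (Fin 3))) :=
    integrable_mul_of_eq_zero_off_compact hφc hφc' (fun x hx => image_eq_zero_of_notMem_tsupport hx)
      (hv₁.mono_set hφ.tsupport_subset)
  have i2 : Integrable (fun x => φ x * g x w) (volume : Measure (EuclideanSpace ℝ (Fin 3))) :=
    integrable_mul_of_eq_zero_off_compact hφc hφc' (fun x hx => image_eq_zero_of_notMem_tsupport hx)
      (IntegrableOn.mono_set ((ContinuousLinearMap.apply ℝ ℝ w).integrable_comp hgi) hφ.tsupport_subset)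
  have e2 : ∫ x, φ x * (v₁ x - g x w) = (∫ x, φ x * v₁ x) - ∫ x, φ x * g x w := by
    rw [← integral_sub i1 i2]
    exact integral_congr_ae (Eventually.of_forall fun x => by ring)
  have e3 : ∫ x, φ x * v₁ x = ∫ x, v₁ x * φ x :=
    integral_congr_ae (Eventually.of_forall fun x => mul_comm _ _)
  rw [e2, e3]
  linarith

end VectorForm

/-! ### The elliptic slice step, `2 ≤ m ≤ 6` -/

section Main

/-- `‖f‖_{L^p(B)} ≤ |B|^{1/p} K` for a function bounded by `K` a.e. [folklore] -/
theorem eLpNorm_le_of_abs_le {α : Type*} [MeasurableSpace α] {μ' : Measure α} {f : α → ℝ} {K : ℝ≥0}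
    {p : ℝ≥0∞} (h : ∀ᵐ x ∂μ', |f x| ≤ K) :
    eLpNorm f p μ' ≤ μ' univ ^ p.toReal⁻¹ * K := by
  have h' : ∀ᵐ x ∂μ', ‖f x‖ ≤ (K : ℝ) := h.mono fun x hx => by rwa [Real.norm_eq_abs]
  have := eLpNorm_le_of_ae_bound (p := p) h'
  rwa [ENNReal.ofReal_coe_nnreal] at this

set_option maxHeartbeats 3200000 in
/-- **The elliptic slice step with constants, `2 ≤ m ≤ 6`** (module docstring). On
`Q = ]-L, 0[ × B(0, R)` let `v, F₀, F₁, F₂` be measurable with `|v|, |F_c| ≤ K` a.e. and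
`∫ v Δψ = -Σ_c ∫ F_c ∂_cψ` for all test functions on `Q`; on `Q₁ = ]-L, 0[ × B(0, R₁)`, `R₁ ≤ R`,
let `v' ∈ L²(Q₁)` represent `∂ᵢv` (`∫ v ∂ᵢψ = -∫ v' ψ`) and `F'_c ∈ L^m(Q₁)` satisfy
`∫ v' Δψ = -Σ_c ∫ F'_c ∂_cψ` for all test functions on `Q₁`. Then for `0 < ρ < R₁`:
`‖v'‖_{L^m(]-L,0[ × B(0,ρ))} ≤ C (K + Σ_c ‖F'_c‖_{L^m(Q₁)})`, `C = C(m, L, ρ, R₁, R)`.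
[folklore] -/
theorem eLpNorm_partial_le_of_poisson_pair {m : ℝ≥0∞} (h2m : 2 ≤ m) (hm6 : m ≤ 6)
    {L ρ R₁ R : ℝ} (hρ : 0 < ρ) (hρR₁ : ρ < R₁) (hR₁R : R₁ ≤ R) :
    ∃ C : ℝ≥0, ∀ (K : ℝ≥0) (v v' : ℝ × EuclideanSpace ℝ (Fin 3) → ℝ)
      (F F' : Fin 3 → ℝ × EuclideanSpace ℝ (Fin 3) → ℝ) (i : Fin 3),
      AEStronglyMeasurable v (volume.restrict (Ioo (-L) 0 ×ˢ ball (0 : EuclideanSpace ℝ (Fin 3)) R)) →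
      (∀ᵐ q ∂(volume.restrict (Ioo (-L) 0 ×ˢ ball (0 : EuclideanSpace ℝ (Fin 3)) R)), |v q| ≤ K) →
      (∀ c, AEStronglyMeasurable (F c)
        (volume.restrict (Ioo (-L) 0 ×ˢ ball (0 : EuclideanSpace ℝ (Fin 3)) R))) →
      (∀ c, ∀ᵐ q ∂(volume.restrict (Ioo (-L) 0 ×ˢ ball (0 : EuclideanSpace ℝ (Fin 3)) R)),
        |F c q| ≤ K) →
      (∀ ψ : ℝ → EuclideanSpace ℝ (Fin 3) → ℝ,
        IsSpaceTimeTestOn (⟨Ioo (-L) 0 ×ˢ ball (0 : EuclideanSpace ℝ (Fin 3)) R,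
          isOpen_Ioo.prod isOpen_ball⟩ : Opens (ℝ × EuclideanSpace ℝ (Fin 3))) ψ →
        ∫ q : ℝ × EuclideanSpace ℝ (Fin 3), v q * (Δ (ψ q.1)) q.2 =
          -∑ c, ∫ q : ℝ × EuclideanSpace ℝ (Fin 3),
            F c q * fderiv ℝ (ψ q.1) q.2 (EuclideanSpace.basisFun (Fin 3) ℝ c)) →
      MemLp v' 2 (volume.restrict (Ioo (-L) 0 ×ˢ ball (0 : EuclideanSpace ℝ (Fin 3)) R₁)) →
      (∀ c, MemLp (F' c) m (volume.restrict (Ioo (-L) 0 ×ˢ ball (0 : EuclideanSpace ℝ (Fin 3)) R₁))) →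
      (∀ ψ : ℝ → EuclideanSpace ℝ (Fin 3) → ℝ,
        IsSpaceTimeTestOn (⟨Ioo (-L) 0 ×ˢ ball (0 : EuclideanSpace ℝ (Fin 3)) R₁,
          isOpen_Ioo.prod isOpen_ball⟩ : Opens (ℝ × EuclideanSpace ℝ (Fin 3))) ψ →
        ∫ q : ℝ × EuclideanSpace ℝ (Fin 3), v q * fderiv ℝ (ψ q.1) q.2 (EuclideanSpace.basisFun (Fin 3) ℝ i) =
          -∫ q : ℝ × EuclideanSpace ℝ (Fin 3), v' q * ψ q.1 q.2) →
      (∀ ψ : ℝ → EuclideanSpace ℝ (Fin 3) → ℝ,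
        IsSpaceTimeTestOn (⟨Ioo (-L) 0 ×ˢ ball (0 : EuclideanSpace ℝ (Fin 3)) R₁,
          isOpen_Ioo.prod isOpen_ball⟩ : Opens (ℝ × EuclideanSpace ℝ (Fin 3))) ψ →
        ∫ q : ℝ × EuclideanSpace ℝ (Fin 3), v' q * (Δ (ψ q.1)) q.2 =
          -∑ c, ∫ q : ℝ × EuclideanSpace ℝ (Fin 3),
            F' c q * fderiv ℝ (ψ q.1) q.2 (EuclideanSpace.basisFun (Fin 3) ℝ c)) →
      eLpNorm v' m (volume.restrict (Ioo (-L) 0 ×ˢ ball (0 : EuclideanSpace ℝ (Fin 3)) ρ)) ≤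
        C * (K + ∑ c, eLpNorm (F' c) m
          (volume.restrict (Ioo (-L) 0 ×ˢ ball (0 : EuclideanSpace ℝ (Fin 3)) R₁))) := by
  -- exponents
  have hm1 : (1 : ℝ≥0∞) ≤ m := one_le_two.trans h2m
  have hm0 : m ≠ 0 := (zero_lt_one.trans_le hm1).ne'
  have hmt : m ≠ ⊤ := ne_top_of_le_ne_top (by norm_num) hm6
  -- radii
  have hR₁0 : 0 < R₁ := hρ.trans hρR₁
  have hR0 : 0 < R := hR₁0.trans_le hR₁R
  set R₂ : ℝ := (ρ + R₁) / 2 with hR₂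
  have hρR₂ : ρ < R₂ := by rw [hR₂]; linarith
  have hR₂R₁ : R₂ < R₁ := by rw [hR₂]; linarith
  have hR₂R : R₂ < R := hR₂R₁.trans_le hR₁R
  have hR₂0 : 0 < R₂ := hρ.trans hρR₂
  -- the three slice constants
  obtain ⟨C₃a, hC₃a⟩ := LaplaceVeryWeak.exists_weakGrad_of_veryWeak (ρ := R₂) (R := R) hR₂0 hR₂R
  obtain ⟨C₃b, hC₃b⟩ := LaplaceVeryWeak.exists_weakGrad_of_veryWeak (ρ := R₂) (R := R₁) hR₂0 hR₂R₁
  obtain ⟨C₆, hC₆⟩ := LaplaceDivFormRoundOne.exists_eLpNorm_six_le (ρ₁ := ρ) (R := R₂) hρ hρR₂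
  -- the constants of the slice bound and of the conclusion
  set VB : ℝ≥0∞ := volume (ball (0 : EuclideanSpace ℝ (Fin 3)) R) ^ (2 : ℝ≥0∞).toReal⁻¹ with hVB
  set W₂ : ℝ≥0∞ := volume (ball (0 : EuclideanSpace ℝ (Fin 3)) R₂) ^ (1 / (2 : ℝ≥0∞).toReal - 1 / m.toReal)
    with hW₂
  set D : ℝ≥0∞ := volume (ball (0 : EuclideanSpace ℝ (Fin 3)) ρ) ^ (1 / m.toReal - 1 / (6 : ℝ≥0∞).toReal)
    with hD
  set VI : ℝ≥0∞ := volume (Ioo (-L) (0 : ℝ)) ^ (1 / m.toReal) with hVI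
  set A₀ : ℝ≥0∞ := D * C₆ * (C₃a * (4 * VB)) with hA₀
  set A₁ : ℝ≥0∞ := D * C₆ * W₂ with hA₁
  have hballt : ∀ r : ℝ, volume (ball (0 : EuclideanSpace ℝ (Fin 3)) r) ≠ ⊤ := fun r =>
    measure_ball_lt_top.ne
  have hVBt : VB ≠ ⊤ := ENNReal.rpow_ne_top_of_nonneg (by positivity) (hballt R)
  have hW₂t : W₂ ≠ ⊤ := by
    refine ENNReal.rpow_ne_top_of_nonneg ?_ (hballt R₂)
    have : 1 / m.toReal ≤ 1 / (2 : ℝ≥0∞).toReal := by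
      rw [ENNReal.toReal_ofNat]
      refine one_div_le_one_div_of_le (by norm_num) ?_
      have := (ENNReal.toReal_le_toReal (by norm_num) hmt).2 h2m
      rwa [ENNReal.toReal_ofNat] at this
    linarith
  have hDt : D ≠ ⊤ := by
    refine ENNReal.rpow_ne_top_of_nonneg ?_ (hballt ρ)
    have : 1 / (6 : ℝ≥0∞).toReal ≤ 1 / m.toReal := by
      refine one_div_le_one_div_of_le (ENNReal.toReal_pos hm0 hmt) ?_
      exact (ENNReal.toReal_le_toReal hmt (by norm_num)).2 hm6
    linarith
  have hVIt : VI ≠ ⊤ := ENNReal.rpow_ne_top_of_nonneg (by positivity) (by simp [Real.volume_Ioo])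
  have hA₀t : A₀ ≠ ⊤ := by
    rw [hA₀]
    exact ENNReal.mul_ne_top (ENNReal.mul_ne_top hDt ENNReal.coe_ne_top)
      (ENNReal.mul_ne_top ENNReal.coe_ne_top (ENNReal.mul_ne_top (by norm_num) hVBt))
  have hA₁t : A₁ ≠ ⊤ := ENNReal.mul_ne_top (ENNReal.mul_ne_top hDt ENNReal.coe_ne_top) hW₂t
  set Ce : ℝ≥0∞ := A₀ * VI + A₁ with hCe
  have hCet : Ce ≠ ⊤ := ENNReal.add_ne_top.2 ⟨ENNReal.mul_ne_top hA₀t hVIt, hA₁t⟩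
  refine ⟨Ce.toNNReal, ?_⟩
  intro K v v' F F' i hvm hvb hFm hFb hid hv' hF' hfo hid'
  rw [ENNReal.coe_toNNReal hCet]
  -- notation for the sets
  set I : Set ℝ := Ioo (-L) 0 with hI
  set BR : Set (EuclideanSpace ℝ (Fin 3)) := ball 0 R with hBR
  set B₁ : Set (EuclideanSpace ℝ (Fin 3)) := ball 0 R₁ with hB₁
  set B₂ : Set (EuclideanSpace ℝ (Fin 3)) := ball 0 R₂ with hB₂
  set Bρ : Set (EuclideanSpace ℝ (Fin 3)) := ball 0 ρ with hBρ
  set ΩR : Opens (EuclideanSpace ℝ (Fin 3)) := ⟨BR, isOpen_ball⟩ with hΩR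
  set Ω₁ : Opens (EuclideanSpace ℝ (Fin 3)) := ⟨B₁, isOpen_ball⟩ with hΩ₁
  set Ω₂ : Opens (EuclideanSpace ℝ (Fin 3)) := ⟨B₂, isOpen_ball⟩ with hΩ₂
  have hB₁R : B₁ ⊆ BR := ball_subset_ball hR₁R
  have hB₂₁ : B₂ ⊆ B₁ := ball_subset_ball hR₂R₁.le
  have hBρ₂ : Bρ ⊆ B₂ := ball_subset_ball hρR₂.le
  have hBρ₁ : Bρ ⊆ B₁ := hBρ₂.trans hB₂₁
  have hprodR : (volume : Measure (ℝ × EuclideanSpace ℝ (Fin 3))).restrict (I ×ˢ BR) =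
      (volume.restrict I).prod (volume.restrict BR) := by
    rw [Measure.volume_eq_prod, Measure.prod_restrict]
  have hprod₁ : (volume : Measure (ℝ × EuclideanSpace ℝ (Fin 3))).restrict (I ×ˢ B₁) =
      (volume.restrict I).prod (volume.restrict B₁) := by
    rw [Measure.volume_eq_prod, Measure.prod_restrict]
  have hprodρ : (volume : Measure (ℝ × EuclideanSpace ℝ (Fin 3))).restrict (I ×ˢ Bρ) =
      (volume.restrict I).prod (volume.restrict Bρ) := by
    rw [Measure.volume_eq_prod, Measure.prod_restrict]
  haveI hfinR : IsFiniteMeasure ((volume : Measure (EuclideanSpace ℝ (Fin 3))).restrict BR) :=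
    isFiniteMeasure_restrict.2 measure_ball_lt_top.ne
  haveI hfin₁ : IsFiniteMeasure ((volume : Measure (EuclideanSpace ℝ (Fin 3))).restrict B₁) :=
    isFiniteMeasure_restrict.2 measure_ball_lt_top.ne
  haveI hfin₂ : IsFiniteMeasure ((volume : Measure (EuclideanSpace ℝ (Fin 3))).restrict B₂) :=
    isFiniteMeasure_restrict.2 measure_ball_lt_top.ne
  have hQ₁fin : volume (I ×ˢ B₁) < ⊤ := by
    rw [Measure.volume_eq_prod, Measure.prod_prod]
    exact ENNReal.mul_lt_top (by simp [hI, Real.volume_Ioo]) measure_ball_lt_top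
  haveI : IsFiniteMeasure ((volume : Measure (ℝ × EuclideanSpace ℝ (Fin 3))).restrict (I ×ˢ B₁)) :=
    isFiniteMeasure_restrict.2 hQ₁fin.ne
  -- local integrability
  have hvb' : ∀ᵐ q ∂(volume : Measure (ℝ × EuclideanSpace ℝ (Fin 3))), q ∈ I ×ˢ BR → |v q| ≤ K :=
    (ae_restrict_iff' (isOpen_Ioo.prod isOpen_ball).measurableSet).1 hvb
  have hFb' : ∀ c, ∀ᵐ q ∂(volume : Measure (ℝ × EuclideanSpace ℝ (Fin 3))), q ∈ I ×ˢ BR → |F c q| ≤ K :=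
    fun c => (ae_restrict_iff' (isOpen_Ioo.prod isOpen_ball).measurableSet).1 (hFb c)
  have hvli : LocallyIntegrableOn v (I ×ˢ BR) volume :=
    locallyIntegrableOn_of_bound (Q := ⟨I ×ˢ BR, isOpen_Ioo.prod isOpen_ball⟩) hvm hvb'
  have hFli : ∀ c, LocallyIntegrableOn (F c) (I ×ˢ BR) volume := fun c =>
    locallyIntegrableOn_of_bound (Q := ⟨I ×ˢ BR, isOpen_Ioo.prod isOpen_ball⟩) (hFm c) (hFb' c)
  have hv'li : LocallyIntegrableOn v' (I ×ˢ B₁) volume :=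
    IntegrableOn.locallyIntegrableOn (hv'.integrable one_le_two)
  have hF'li : ∀ c, LocallyIntegrableOn (F' c) (I ×ˢ B₁) volume := fun c =>
    IntegrableOn.locallyIntegrableOn ((hF' c).integrable hm1)
  -- the a.e.-in-time facts
  have e1 := ae_slice_poisson (EuclideanSpace.basisFun (Fin 3) ℝ) (Ω := ΩR) hvli hFli hid
  have e2 := ae_slice_poisson (EuclideanSpace.basisFun (Fin 3) ℝ) (Ω := Ω₁) hv'li hF'li hid'
  have e3 := ae_slice_firstOrder (Ω := Ω₁) (hvli.mono_set (prod_mono Subset.rfl hB₁R)) hv'li hfo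
  have e4 : ∀ᵐ t ∂(volume.restrict I), ∀ᵐ x ∂(volume.restrict BR), |v (t, x)| ≤ K :=
    ae_slice_bound (μ := volume.restrict I) (ν := volume.restrict BR) (hprodR ▸ hvb)
  have e5 : ∀ᵐ t ∂(volume.restrict I), ∀ c, ∀ᵐ x ∂(volume.restrict BR), |F c (t, x)| ≤ K :=
    ae_all_iff.2 fun c => ae_slice_bound (μ := volume.restrict I) (ν := volume.restrict BR) (hprodR ▸ hFb c)
  have e6 : ∀ᵐ t ∂(volume.restrict I), AEStronglyMeasurable (fun x => v (t, x)) (volume.restrict BR) :=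
    (hprodR ▸ hvm).prodMk_left
  have e7 : ∀ᵐ t ∂(volume.restrict I), ∀ c,
      AEStronglyMeasurable (fun x => F c (t, x)) (volume.restrict BR) :=
    ae_all_iff.2 fun c => (hprodR ▸ hFm c).prodMk_left
  have e8 : ∀ᵐ t ∂(volume.restrict I), MemLp (fun x => v' (t, x)) 2 (volume.restrict B₁) :=
    ae_memLp_two_slice (hprod₁ ▸ hv')
  have e9 : ∀ᵐ t ∂(volume.restrict I), ∀ c, MemLp (fun x => F' c (t, x)) m (volume.restrict B₁) :=
    ae_all_iff.2 fun c => ae_memLp_slice hm0 hmt (hprod₁ ▸ hF' c)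
  -- the slice bound
  have hslice : ∀ᵐ t ∂(volume.restrict I),
      eLpNorm (fun x => v' (t, x)) m (volume.restrict Bρ) ≤
        A₀ * K + A₁ * ∑ c, eLpNorm (fun x => F' c (t, x)) m (volume.restrict B₁) := by
    filter_upwards [e1, e2, e3, e4, e5, e6, e7, e8, e9] with t h1 h2 h3 h4 h5 h6 h7 h8 h9
    -- level `γ`: the data of the slice
    have hvt2 : MemLp (fun x => v (t, x)) 2 (volume.restrict BR) :=
      (memLp_const (K : ℝ)).of_le h6 (h4.mono fun x hx => by
        rw [Real.norm_eq_abs, Real.norm_of_nonneg K.coe_nonneg]; exact hx)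
    have hvt2n : eLpNorm (fun x => v (t, x)) 2 (volume.restrict BR) ≤ VB * K := by
      have := eLpNorm_le_of_abs_le (p := 2) h4
      rwa [Measure.restrict_apply_univ] at this
    have hFt2 : ∀ c, MemLp (fun x => F c (t, x)) 2 (volume.restrict BR) := fun c =>
      (memLp_const (K : ℝ)).of_le (h7 c) ((h5 c).mono fun x hx => by
        rw [Real.norm_eq_abs, Real.norm_of_nonneg K.coe_nonneg]; exact hx)
    have hFt2n : ∀ c, eLpNorm (fun x => F c (t, x)) 2 (volume.restrict BR) ≤ VB * K := by
      intro c
      have := eLpNorm_le_of_abs_le (p := 2) (h5 c)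
      rwa [Measure.restrict_apply_univ] at this
    obtain ⟨hFvm, hFvn⟩ := memLp_toLp_of_components (μ' := volume.restrict BR) one_le_two hFt2
    have hFvn' : eLpNorm (fun x => (WithLp.toLp 2 (fun c => F c (t, x)) : EuclideanSpace ℝ (Fin 3))) 2
        (volume.restrict BR) ≤ 3 * (VB * K) := by
      refine hFvn.trans ?_
      calc ∑ c, eLpNorm (fun x => F c (t, x)) 2 (volume.restrict BR) ≤ ∑ _c : Fin 3, VB * K :=
            Finset.sum_le_sum fun c _ => hFt2n c
        _ = 3 * (VB * K) := by rw [Finset.sum_const, Finset.card_univ, Fintype.card_fin]; ring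
    have hidγ := poisson_vector_form_of_slice (x₀ := 0) (R := R)
      (fun c => (hFt2 c).integrable one_le_two) h1
    obtain ⟨g, hg, hgm, hgn, -⟩ := hC₃a 0 (fun x => v (t, x)) _ hvt2 hFvm hidγ
    -- `v'(t) = g eᵢ` a.e. on `B₂`
    have hv't1 : IntegrableOn (fun x => v' (t, x)) B₂ volume :=
      IntegrableOn.mono_set (h8.integrable one_le_two) hB₂₁
    have hgi : IntegrableOn g B₂ volume := hgm.integrable one_le_two
    have hident : ∀ᵐ x ∂(volume : Measure (EuclideanSpace ℝ (Fin 3))), x ∈ B₂ →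
        v' (t, x) = g x (EuclideanSpace.basisFun (Fin 3) ℝ i) :=
      ae_eq_weakDeriv_apply hg hv't1 hgi fun φ hφ => h3 φ (hφ.mono (show Ω₂ ≤ Ω₁ from hB₂₁))
    have hv't2n : eLpNorm (fun x => v' (t, x)) 2 (volume.restrict B₂) ≤ C₃a * (4 * VB) * K := by
      have e : eLpNorm (fun x => v' (t, x)) 2 (volume.restrict B₂) =
          eLpNorm (fun x => g x (EuclideanSpace.basisFun (Fin 3) ℝ i)) 2 (volume.restrict B₂) :=
        eLpNorm_congr_ae ((ae_restrict_iff' measurableSet_ball).2 hident)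
      rw [e]
      have hle : eLpNorm (fun x => g x (EuclideanSpace.basisFun (Fin 3) ℝ i)) 2 (volume.restrict B₂) ≤
          eLpNorm g 2 (volume.restrict B₂) := by
        refine eLpNorm_mono fun x => ?_
        calc ‖g x (EuclideanSpace.basisFun (Fin 3) ℝ i)‖ ≤ ‖g x‖ * ‖EuclideanSpace.basisFun (Fin 3) ℝ i‖ :=
              (g x).le_opNorm _
          _ = ‖g x‖ := by simp
      refine hle.trans (hgn.trans ?_)
      calc (C₃a : ℝ≥0∞) * (eLpNorm (fun x => v (t, x)) 2 (volume.restrict (ball 0 R)) +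
            eLpNorm (fun x => (WithLp.toLp 2 (fun c => F c (t, x)) : EuclideanSpace ℝ (Fin 3))) 2
              (volume.restrict (ball 0 R)))
          ≤ C₃a * (VB * K + 3 * (VB * K)) := mul_le_mul' le_rfl (add_le_add hvt2n hFvn')
        _ = C₃a * (4 * VB) * K := by ring
    -- level `β`: the slice is `W^{1,2}` with the gradient-form equation on `B₂`
    have hF't2 : ∀ c, MemLp (fun x => F' c (t, x)) 2 (volume.restrict B₁) := fun c =>
      (h9 c).mono_exponent h2m
    obtain ⟨hF'vm, -⟩ := memLp_toLp_of_components (μ' := volume.restrict B₁) one_le_two hF't2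
    have hidβ := poisson_vector_form_of_slice (x₀ := 0) (R := R₁)
      (fun c => (hF't2 c).integrable one_le_two) h2
    obtain ⟨g', hg', hg'm, -, hg'eq⟩ := hC₃b 0 (fun x => v' (t, x)) _ h8 hF'vm hidβ
    -- the `L⁶` round on `B₂ → B_ρ`
    have h8' : MemLp (fun x => v' (t, x)) 2 (volume.restrict B₂) :=
      h8.mono_measure (Measure.restrict_mono hB₂₁ le_rfl)
    have hF't2' : ∀ c, MemLp (fun x => F' c (t, x)) 2 (volume.restrict B₂) := fun c =>
      (hF't2 c).mono_measure (Measure.restrict_mono hB₂₁ le_rfl)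
    obtain ⟨hF'vm₂, hF'vn₂⟩ := memLp_toLp_of_components (μ' := volume.restrict B₂) one_le_two hF't2'
    have hsix := hC₆ 0 (fun x => v' (t, x)) g' _ hg' h8' hg'm hF'vm₂ hg'eq
    -- `L^m → L²` for `F'_c(t)` on `B₂`, and `B₂ ⊆ B₁`
    have hF'c2 : ∀ c, eLpNorm (fun x => F' c (t, x)) 2 (volume.restrict B₂) ≤
        W₂ * eLpNorm (fun x => F' c (t, x)) m (volume.restrict B₁) := by
      intro c
      have h := eLpNorm_le_eLpNorm_mul_rpow_measure_univ h2m
        ((hF't2' c).1 : AEStronglyMeasurable (fun x => F' c (t, x)) (volume.restrict B₂))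
      rw [Measure.restrict_apply_univ] at h
      refine h.trans ?_
      rw [mul_comm]
      exact mul_le_mul' le_rfl (eLpNorm_mono_measure _ (Measure.restrict_mono hB₂₁ le_rfl))
    -- `L⁶ → L^m` for `v'(t)` on `B_ρ`
    have hv'mρ : eLpNorm (fun x => v' (t, x)) m (volume.restrict Bρ) ≤
        D * eLpNorm (fun x => v' (t, x)) 6 (volume.restrict Bρ) := by
      have hmeas : AEStronglyMeasurable (fun x => v' (t, x)) (volume.restrict Bρ) :=
        h8.1.mono_measure (Measure.restrict_mono hBρ₁ le_rfl)
      have h := eLpNorm_le_eLpNorm_mul_rpow_measure_univ hm6 hmeas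
      rw [Measure.restrict_apply_univ] at h
      rw [mul_comm]; exact h
    -- assembly
    calc eLpNorm (fun x => v' (t, x)) m (volume.restrict Bρ)
        ≤ D * eLpNorm (fun x => v' (t, x)) 6 (volume.restrict Bρ) := hv'mρ
      _ ≤ D * (C₆ * (eLpNorm (fun x => v' (t, x)) 2 (volume.restrict (ball 0 R₂)) +
            eLpNorm (fun x => (WithLp.toLp 2 (fun c => F' c (t, x)) : EuclideanSpace ℝ (Fin 3))) 2
              (volume.restrict (ball 0 R₂)))) := mul_le_mul' le_rfl hsix
      _ ≤ D * (C₆ * (C₃a * (4 * VB) * K + W₂ * ∑ c, eLpNorm (fun x => F' c (t, x)) m (volume.restrict B₁))) := by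
          refine mul_le_mul' le_rfl (mul_le_mul' le_rfl (add_le_add hv't2n (hF'vn₂.trans ?_)))
          rw [Finset.mul_sum]
          exact Finset.sum_le_sum fun c _ => hF'c2 c
      _ = A₀ * K + A₁ * ∑ c, eLpNorm (fun x => F' c (t, x)) m (volume.restrict B₁) := by
          rw [hA₀, hA₁]; ring
  -- integrate in time
  have hW : AEStronglyMeasurable v' ((volume.restrict I).prod (volume.restrict Bρ)) := by
    rw [← hprodρ]
    exact hv'.1.mono_measure (Measure.restrict_mono (prod_mono Subset.rfl hBρ₁) le_rfl)
  have hn : ∀ c, AEStronglyMeasurable (F' c) ((volume.restrict I).prod (volume.restrict B₁)) :=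
    fun c => hprod₁ ▸ (hF' c).1
  have hmain := eLpNorm_prod_le_of_slice_bound (μ := volume.restrict I) (ν := volume.restrict Bρ)
    (ν₁ := volume.restrict B₁) hm1 hmt hW hn (A₀ := A₀ * K) (A₁ := A₁) hslice
  rw [← hprodρ, ← hprod₁, Measure.restrict_apply_univ] at hmain
  refine hmain.trans ?_
  rw [hCe]
  calc A₀ * K * (volume I) ^ (1 / m.toReal) + A₁ * ∑ c, eLpNorm (F' c) m (volume.restrict (I ×ˢ B₁))
      = (A₀ * VI) * K + A₁ * ∑ c, eLpNorm (F' c) m (volume.restrict (I ×ˢ B₁)) := by rw [hVI]; ring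
    _ ≤ (A₀ * VI + A₁) * K + (A₀ * VI + A₁) * ∑ c, eLpNorm (F' c) m (volume.restrict (I ×ˢ B₁)) :=
        add_le_add (mul_le_mul' le_self_add le_rfl) (mul_le_mul' le_add_self le_rfl)
    _ = (A₀ * VI + A₁) * (K + ∑ c, eLpNorm (F' c) m (volume.restrict (I ×ˢ B₁))) := by ring

end Main


/-! ### The elliptic slice step, `m = ∞` -/

section MainTop

set_option maxHeartbeats 3200000 in
/-- **The elliptic slice step with constants, `m = ∞`** (module docstring): with the data of
`eLpNorm_partial_le_of_poisson_pair` but `F'_c ∈ L^∞(Q₁)`, the representative `v'` of `∂ᵢv` is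
essentially bounded on `]-L, 0[ × B(0, ρ)` by `C (K + Σ_c ‖F'_c‖_{L^∞(Q₁)})`,
`C = C(L, ρ, R₁, R)` (De Giorgi–Nash–Moser at fixed times). [folklore] -/
theorem ae_enorm_partial_le_of_poisson_pair
    {L ρ R₁ R : ℝ} (hρ : 0 < ρ) (hρR₁ : ρ < R₁) (hR₁R : R₁ ≤ R) :
    ∃ C : ℝ≥0, ∀ (K : ℝ≥0) (v v' : ℝ × EuclideanSpace ℝ (Fin 3) → ℝ)
      (F F' : Fin 3 → ℝ × EuclideanSpace ℝ (Fin 3) → ℝ) (i : Fin 3),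
      AEStronglyMeasurable v (volume.restrict (Ioo (-L) 0 ×ˢ ball (0 : EuclideanSpace ℝ (Fin 3)) R)) →
      (∀ᵐ q ∂(volume.restrict (Ioo (-L) 0 ×ˢ ball (0 : EuclideanSpace ℝ (Fin 3)) R)), |v q| ≤ K) →
      (∀ c, AEStronglyMeasurable (F c)
        (volume.restrict (Ioo (-L) 0 ×ˢ ball (0 : EuclideanSpace ℝ (Fin 3)) R))) →
      (∀ c, ∀ᵐ q ∂(volume.restrict (Ioo (-L) 0 ×ˢ ball (0 : EuclideanSpace ℝ (Fin 3)) R)),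
        |F c q| ≤ K) →
      (∀ ψ : ℝ → EuclideanSpace ℝ (Fin 3) → ℝ,
        IsSpaceTimeTestOn (⟨Ioo (-L) 0 ×ˢ ball (0 : EuclideanSpace ℝ (Fin 3)) R,
          isOpen_Ioo.prod isOpen_ball⟩ : Opens (ℝ × EuclideanSpace ℝ (Fin 3))) ψ →
        ∫ q : ℝ × EuclideanSpace ℝ (Fin 3), v q * (Δ (ψ q.1)) q.2 =
          -∑ c, ∫ q : ℝ × EuclideanSpace ℝ (Fin 3),
            F c q * fderiv ℝ (ψ q.1) q.2 (EuclideanSpace.basisFun (Fin 3) ℝ c)) →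
      MemLp v' 2 (volume.restrict (Ioo (-L) 0 ×ˢ ball (0 : EuclideanSpace ℝ (Fin 3)) R₁)) →
      (∀ c, MemLp (F' c) ∞ (volume.restrict (Ioo (-L) 0 ×ˢ ball (0 : EuclideanSpace ℝ (Fin 3)) R₁))) →
      (∀ ψ : ℝ → EuclideanSpace ℝ (Fin 3) → ℝ,
        IsSpaceTimeTestOn (⟨Ioo (-L) 0 ×ˢ ball (0 : EuclideanSpace ℝ (Fin 3)) R₁,
          isOpen_Ioo.prod isOpen_ball⟩ : Opens (ℝ × EuclideanSpace ℝ (Fin 3))) ψ →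
        ∫ q : ℝ × EuclideanSpace ℝ (Fin 3), v q * fderiv ℝ (ψ q.1) q.2 (EuclideanSpace.basisFun (Fin 3) ℝ i) =
          -∫ q : ℝ × EuclideanSpace ℝ (Fin 3), v' q * ψ q.1 q.2) →
      (∀ ψ : ℝ → EuclideanSpace ℝ (Fin 3) → ℝ,
        IsSpaceTimeTestOn (⟨Ioo (-L) 0 ×ˢ ball (0 : EuclideanSpace ℝ (Fin 3)) R₁,
          isOpen_Ioo.prod isOpen_ball⟩ : Opens (ℝ × EuclideanSpace ℝ (Fin 3))) ψ →
        ∫ q : ℝ × EuclideanSpace ℝ (Fin 3), v' q * (Δ (ψ q.1)) q.2 =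
          -∑ c, ∫ q : ℝ × EuclideanSpace ℝ (Fin 3),
            F' c q * fderiv ℝ (ψ q.1) q.2 (EuclideanSpace.basisFun (Fin 3) ℝ c)) →
      ∀ᵐ q ∂(volume.restrict (Ioo (-L) 0 ×ˢ ball (0 : EuclideanSpace ℝ (Fin 3)) ρ)),
        ‖v' q‖ₑ ≤ C * (K + ∑ c, eLpNorm (F' c) ∞
          (volume.restrict (Ioo (-L) 0 ×ˢ ball (0 : EuclideanSpace ℝ (Fin 3)) R₁))) := by
  -- radii
  have hR₁0 : 0 < R₁ := hρ.trans hρR₁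
  have hR0 : 0 < R := hR₁0.trans_le hR₁R
  set R₂ : ℝ := (ρ + R₁) / 2 with hR₂
  have hρR₂ : ρ < R₂ := by rw [hR₂]; linarith
  have hR₂R₁ : R₂ < R₁ := by rw [hR₂]; linarith
  have hR₂R : R₂ < R := hR₂R₁.trans_le hR₁R
  have hR₂0 : 0 < R₂ := hρ.trans hρR₂
  -- the slice constants
  obtain ⟨C₃a, hC₃a⟩ := LaplaceVeryWeak.exists_weakGrad_of_veryWeak (ρ := R₂) (R := R) hR₂0 hR₂R
  obtain ⟨C₃b, hC₃b⟩ := LaplaceVeryWeak.exists_weakGrad_of_veryWeak (ρ := R₂) (R := R₁) hR₂0 hR₂R₁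
  obtain ⟨CdG, αdG, -, hdG⟩ := LaplaceDivFormInteriorHolder_holds ⊤ R₂ ρ (by simp) hρ hρR₂
  set VB : ℝ≥0∞ := volume (ball (0 : EuclideanSpace ℝ (Fin 3)) R) ^ (2 : ℝ≥0∞).toReal⁻¹ with hVB
  set A₀ : ℝ≥0∞ := CdG * (C₃a * (4 * VB)) with hA₀
  have hVBt : VB ≠ ⊤ := ENNReal.rpow_ne_top_of_nonneg (by positivity) measure_ball_lt_top.ne
  have hA₀t : A₀ ≠ ⊤ := ENNReal.mul_ne_top ENNReal.coe_ne_top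
    (ENNReal.mul_ne_top ENNReal.coe_ne_top (ENNReal.mul_ne_top (by norm_num) hVBt))
  set Ce : ℝ≥0∞ := A₀ + CdG with hCe
  have hCet : Ce ≠ ⊤ := ENNReal.add_ne_top.2 ⟨hA₀t, ENNReal.coe_ne_top⟩
  refine ⟨Ce.toNNReal, ?_⟩
  intro K v v' F F' i hvm hvb hFm hFb hid hv' hF' hfo hid'
  rw [ENNReal.coe_toNNReal hCet]
  -- sets
  set I : Set ℝ := Ioo (-L) 0 with hI
  set BR : Set (EuclideanSpace ℝ (Fin 3)) := ball 0 R with hBR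
  set B₁ : Set (EuclideanSpace ℝ (Fin 3)) := ball 0 R₁ with hB₁
  set B₂ : Set (EuclideanSpace ℝ (Fin 3)) := ball 0 R₂ with hB₂
  set Bρ : Set (EuclideanSpace ℝ (Fin 3)) := ball 0 ρ with hBρ
  set ΩR : Opens (EuclideanSpace ℝ (Fin 3)) := ⟨BR, isOpen_ball⟩ with hΩR
  set Ω₁ : Opens (EuclideanSpace ℝ (Fin 3)) := ⟨B₁, isOpen_ball⟩ with hΩ₁
  set Ω₂ : Opens (EuclideanSpace ℝ (Fin 3)) := ⟨B₂, isOpen_ball⟩ with hΩ₂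
  have hB₁R : B₁ ⊆ BR := ball_subset_ball hR₁R
  have hB₂₁ : B₂ ⊆ B₁ := ball_subset_ball hR₂R₁.le
  have hBρ₂ : Bρ ⊆ B₂ := ball_subset_ball hρR₂.le
  have hBρ₁ : Bρ ⊆ B₁ := hBρ₂.trans hB₂₁
  have hprodR : (volume : Measure (ℝ × EuclideanSpace ℝ (Fin 3))).restrict (I ×ˢ BR) =
      (volume.restrict I).prod (volume.restrict BR) := by
    rw [Measure.volume_eq_prod, Measure.prod_restrict]
  have hprod₁ : (volume : Measure (ℝ × EuclideanSpace ℝ (Fin 3))).restrict (I ×ˢ B₁) =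
      (volume.restrict I).prod (volume.restrict B₁) := by
    rw [Measure.volume_eq_prod, Measure.prod_restrict]
  have hprodρ : (volume : Measure (ℝ × EuclideanSpace ℝ (Fin 3))).restrict (I ×ˢ Bρ) =
      (volume.restrict I).prod (volume.restrict Bρ) := by
    rw [Measure.volume_eq_prod, Measure.prod_restrict]
  haveI hfinR : IsFiniteMeasure ((volume : Measure (EuclideanSpace ℝ (Fin 3))).restrict BR) :=
    isFiniteMeasure_restrict.2 measure_ball_lt_top.ne
  haveI hfin₁ : IsFiniteMeasure ((volume : Measure (EuclideanSpace ℝ (Fin 3))).restrict B₁) :=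
    isFiniteMeasure_restrict.2 measure_ball_lt_top.ne
  haveI hfin₂ : IsFiniteMeasure ((volume : Measure (EuclideanSpace ℝ (Fin 3))).restrict B₂) :=
    isFiniteMeasure_restrict.2 measure_ball_lt_top.ne
  have hQ₁fin : volume (I ×ˢ B₁) < ⊤ := by
    rw [Measure.volume_eq_prod, Measure.prod_prod]
    exact ENNReal.mul_lt_top (by simp [hI, Real.volume_Ioo]) measure_ball_lt_top
  haveI : IsFiniteMeasure ((volume : Measure (ℝ × EuclideanSpace ℝ (Fin 3))).restrict (I ×ˢ B₁)) :=
    isFiniteMeasure_restrict.2 hQ₁fin.ne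
  -- local integrability
  have hvb' : ∀ᵐ q ∂(volume : Measure (ℝ × EuclideanSpace ℝ (Fin 3))), q ∈ I ×ˢ BR → |v q| ≤ K :=
    (ae_restrict_iff' (isOpen_Ioo.prod isOpen_ball).measurableSet).1 hvb
  have hFb' : ∀ c, ∀ᵐ q ∂(volume : Measure (ℝ × EuclideanSpace ℝ (Fin 3))), q ∈ I ×ˢ BR → |F c q| ≤ K :=
    fun c => (ae_restrict_iff' (isOpen_Ioo.prod isOpen_ball).measurableSet).1 (hFb c)
  have hvli : LocallyIntegrableOn v (I ×ˢ BR) volume :=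
    locallyIntegrableOn_of_bound (Q := ⟨I ×ˢ BR, isOpen_Ioo.prod isOpen_ball⟩) hvm hvb'
  have hFli : ∀ c, LocallyIntegrableOn (F c) (I ×ˢ BR) volume := fun c =>
    locallyIntegrableOn_of_bound (Q := ⟨I ×ˢ BR, isOpen_Ioo.prod isOpen_ball⟩) (hFm c) (hFb' c)
  have hv'li : LocallyIntegrableOn v' (I ×ˢ B₁) volume :=
    IntegrableOn.locallyIntegrableOn (hv'.integrable one_le_two)
  have hF'li : ∀ c, LocallyIntegrableOn (F' c) (I ×ˢ B₁) volume := fun c =>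
    IntegrableOn.locallyIntegrableOn ((hF' c).integrable le_top)
  -- a.e. in time
  have e1 := ae_slice_poisson (EuclideanSpace.basisFun (Fin 3) ℝ) (Ω := ΩR) hvli hFli hid
  have e2 := ae_slice_poisson (EuclideanSpace.basisFun (Fin 3) ℝ) (Ω := Ω₁) hv'li hF'li hid'
  have e3 := ae_slice_firstOrder (Ω := Ω₁) (hvli.mono_set (prod_mono Subset.rfl hB₁R)) hv'li hfo
  have e4 : ∀ᵐ t ∂(volume.restrict I), ∀ᵐ x ∂(volume.restrict BR), |v (t, x)| ≤ K :=
    ae_slice_bound (μ := volume.restrict I) (ν := volume.restrict BR) (hprodR ▸ hvb)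
  have e5 : ∀ᵐ t ∂(volume.restrict I), ∀ c, ∀ᵐ x ∂(volume.restrict BR), |F c (t, x)| ≤ K :=
    ae_all_iff.2 fun c => ae_slice_bound (μ := volume.restrict I) (ν := volume.restrict BR) (hprodR ▸ hFb c)
  have e6 : ∀ᵐ t ∂(volume.restrict I), AEStronglyMeasurable (fun x => v (t, x)) (volume.restrict BR) :=
    (hprodR ▸ hvm).prodMk_left
  have e7 : ∀ᵐ t ∂(volume.restrict I), ∀ c,
      AEStronglyMeasurable (fun x => F c (t, x)) (volume.restrict BR) :=
    ae_all_iff.2 fun c => (hprodR ▸ hFm c).prodMk_left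
  have e8 : ∀ᵐ t ∂(volume.restrict I), MemLp (fun x => v' (t, x)) 2 (volume.restrict B₁) :=
    ae_memLp_two_slice (hprod₁ ▸ hv')
  have e9 : ∀ᵐ t ∂(volume.restrict I), ∀ c,
      AEStronglyMeasurable (fun x => F' c (t, x)) (volume.restrict B₁) :=
    ae_all_iff.2 fun c => (hprod₁ ▸ (hF' c).1).prodMk_left
  have e10 : ∀ᵐ t ∂(volume.restrict I), ∀ c,
      eLpNorm (fun x => F' c (t, x)) ∞ (volume.restrict B₁) ≤ eLpNorm (F' c) ∞ (volume.restrict (I ×ˢ B₁)) := by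
    refine ae_all_iff.2 fun c => ?_
    have h := ae_eLpNorm_top_slice_le (μ := volume.restrict I) (ν := volume.restrict B₁) (F' c)
    rw [← hprod₁] at h
    exact h
  set S : ℝ≥0∞ := ∑ c, eLpNorm (F' c) ∞ (volume.restrict (I ×ˢ B₁)) with hS
  have hSt : S ≠ ⊤ := (ENNReal.sum_lt_top.2 fun c _ => (hF' c).eLpNorm_lt_top).ne
  -- the slice bound
  have hslice : ∀ᵐ t ∂(volume.restrict I), ∀ᵐ x ∂(volume.restrict Bρ),
      ‖v' (t, x)‖ₑ ≤ A₀ * K + CdG * S := by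
    filter_upwards [e1, e2, e3, e4, e5, e6, e7, e8, e9, e10] with t h1 h2 h3 h4 h5 h6 h7 h8 h9 h10
    -- level `γ`
    have hvt2 : MemLp (fun x => v (t, x)) 2 (volume.restrict BR) :=
      (memLp_const (K : ℝ)).of_le h6 (h4.mono fun x hx => by
        rw [Real.norm_eq_abs, Real.norm_of_nonneg K.coe_nonneg]; exact hx)
    have hvt2n : eLpNorm (fun x => v (t, x)) 2 (volume.restrict BR) ≤ VB * K := by
      have := eLpNorm_le_of_abs_le (p := 2) h4
      rwa [Measure.restrict_apply_univ] at this
    have hFt2 : ∀ c, MemLp (fun x => F c (t, x)) 2 (volume.restrict BR) := fun c =>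
      (memLp_const (K : ℝ)).of_le (h7 c) ((h5 c).mono fun x hx => by
        rw [Real.norm_eq_abs, Real.norm_of_nonneg K.coe_nonneg]; exact hx)
    have hFt2n : ∀ c, eLpNorm (fun x => F c (t, x)) 2 (volume.restrict BR) ≤ VB * K := by
      intro c
      have := eLpNorm_le_of_abs_le (p := 2) (h5 c)
      rwa [Measure.restrict_apply_univ] at this
    obtain ⟨hFvm, hFvn⟩ := memLp_toLp_of_components (μ' := volume.restrict BR) one_le_two hFt2
    have hFvn' : eLpNorm (fun x => (WithLp.toLp 2 (fun c => F c (t, x)) : EuclideanSpace ℝ (Fin 3))) 2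
        (volume.restrict BR) ≤ 3 * (VB * K) := by
      refine hFvn.trans ?_
      calc ∑ c, eLpNorm (fun x => F c (t, x)) 2 (volume.restrict BR) ≤ ∑ _c : Fin 3, VB * K :=
            Finset.sum_le_sum fun c _ => hFt2n c
        _ = 3 * (VB * K) := by rw [Finset.sum_const, Finset.card_univ, Fintype.card_fin]; ring
    have hidγ := poisson_vector_form_of_slice (x₀ := 0) (R := R)
      (fun c => (hFt2 c).integrable one_le_two) h1
    obtain ⟨g, hg, hgm, hgn, -⟩ := hC₃a 0 (fun x => v (t, x)) _ hvt2 hFvm hidγ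
    have hv't1 : IntegrableOn (fun x => v' (t, x)) B₂ volume :=
      IntegrableOn.mono_set (h8.integrable one_le_two) hB₂₁
    have hgi : IntegrableOn g B₂ volume := hgm.integrable one_le_two
    have hident : ∀ᵐ x ∂(volume : Measure (EuclideanSpace ℝ (Fin 3))), x ∈ B₂ →
        v' (t, x) = g x (EuclideanSpace.basisFun (Fin 3) ℝ i) :=
      ae_eq_weakDeriv_apply hg hv't1 hgi fun φ hφ => h3 φ (hφ.mono (show Ω₂ ≤ Ω₁ from hB₂₁))
    have hv't2n : eLpNorm (fun x => v' (t, x)) 2 (volume.restrict B₂) ≤ C₃a * (4 * VB) * K := by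
      have e : eLpNorm (fun x => v' (t, x)) 2 (volume.restrict B₂) =
          eLpNorm (fun x => g x (EuclideanSpace.basisFun (Fin 3) ℝ i)) 2 (volume.restrict B₂) :=
        eLpNorm_congr_ae ((ae_restrict_iff' measurableSet_ball).2 hident)
      rw [e]
      have hle : eLpNorm (fun x => g x (EuclideanSpace.basisFun (Fin 3) ℝ i)) 2 (volume.restrict B₂) ≤
          eLpNorm g 2 (volume.restrict B₂) := by
        refine eLpNorm_mono fun x => ?_
        calc ‖g x (EuclideanSpace.basisFun (Fin 3) ℝ i)‖ ≤ ‖g x‖ * ‖EuclideanSpace.basisFun (Fin 3) ℝ i‖ :=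
              (g x).le_opNorm _
          _ = ‖g x‖ := by simp
      refine hle.trans (hgn.trans ?_)
      calc (C₃a : ℝ≥0∞) * (eLpNorm (fun x => v (t, x)) 2 (volume.restrict (ball 0 R)) +
            eLpNorm (fun x => (WithLp.toLp 2 (fun c => F c (t, x)) : EuclideanSpace ℝ (Fin 3))) 2
              (volume.restrict (ball 0 R)))
          ≤ C₃a * (VB * K + 3 * (VB * K)) := mul_le_mul' le_rfl (add_le_add hvt2n hFvn')
        _ = C₃a * (4 * VB) * K := by ring
    -- level `β`
    have hF'tT : ∀ c, MemLp (fun x => F' c (t, x)) ∞ (volume.restrict B₁) := fun c =>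
      ⟨h9 c, (h10 c).trans_lt (hF' c).eLpNorm_lt_top⟩
    have hF't2 : ∀ c, MemLp (fun x => F' c (t, x)) 2 (volume.restrict B₁) := fun c =>
      (hF'tT c).mono_exponent le_top
    obtain ⟨hF'vm, -⟩ := memLp_toLp_of_components (μ' := volume.restrict B₁) one_le_two hF't2
    have hidβ := poisson_vector_form_of_slice (x₀ := 0) (R := R₁)
      (fun c => (hF't2 c).integrable one_le_two) h2
    obtain ⟨g', hg', hg'm, -, hg'eq⟩ := hC₃b 0 (fun x => v' (t, x)) _ h8 hF'vm hidβ
    -- De Giorgi on `B₂ → B_ρ` with `q = ∞`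
    have h8' : MemLp (fun x => v' (t, x)) 2 (volume.restrict B₂) :=
      h8.mono_measure (Measure.restrict_mono hB₂₁ le_rfl)
    have hF'tT' : ∀ c, MemLp (fun x => F' c (t, x)) ∞ (volume.restrict B₂) := fun c =>
      (hF'tT c).mono_measure (Measure.restrict_mono hB₂₁ le_rfl)
    obtain ⟨hF'vmT, hF'vnT⟩ := memLp_toLp_of_components (μ' := volume.restrict B₂) le_top hF'tT'
    obtain ⟨w', hw'eq, hw'b, -⟩ := hdG 0 (fun x => v' (t, x)) g' _ hg' h8' hg'm hF'vmT hg'eq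
    -- the quantity inside the De Giorgi bound
    set T : ℝ≥0∞ := eLpNorm (fun x => v' (t, x)) 2 (volume.restrict (ball 0 R₂)) +
      eLpNorm (fun x => (WithLp.toLp 2 (fun c => F' c (t, x)) : EuclideanSpace ℝ (Fin 3))) ⊤
        (volume.restrict (ball 0 R₂)) with hT
    have hT_le : T ≤ C₃a * (4 * VB) * K + S := by
      refine add_le_add hv't2n (hF'vnT.trans ?_)
      refine Finset.sum_le_sum fun c _ => ?_
      exact (eLpNorm_mono_measure _ (Measure.restrict_mono hB₂₁ le_rfl)).trans (h10 c)
    have hTt : T ≠ ⊤ := ne_top_of_le_ne_top (ENNReal.add_ne_top.2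
      ⟨ENNReal.mul_ne_top (ENNReal.mul_ne_top ENNReal.coe_ne_top
        (ENNReal.mul_ne_top (by norm_num) hVBt)) ENNReal.coe_ne_top, hSt⟩) hT_le
    -- from the representative to `v'(t)`
    have hae : ∀ᵐ x ∂(volume.restrict Bρ), v' (t, x) = w' x := hw'eq
    have hmem : ∀ᵐ x ∂(volume.restrict Bρ), x ∈ Bρ := ae_restrict_mem measurableSet_ball
    filter_upwards [hae, hmem] with x hx hxB
    rw [hx, Real.enorm_eq_ofReal_abs]
    calc ENNReal.ofReal |w' x| ≤ ENNReal.ofReal (CdG * T.toReal) := ENNReal.ofReal_le_ofReal (hw'b x hxB)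
      _ = CdG * T := by
          rw [ENNReal.ofReal_mul (NNReal.coe_nonneg _), ENNReal.ofReal_coe_nnreal, ENNReal.ofReal_toReal hTt]
      _ ≤ CdG * (C₃a * (4 * VB) * K + S) := mul_le_mul' le_rfl hT_le
      _ = A₀ * K + CdG * S := by rw [hA₀]; ring
  -- to the product
  have hW : AEStronglyMeasurable v' ((volume.restrict I).prod (volume.restrict Bρ)) := by
    rw [← hprodρ]
    exact hv'.1.mono_measure (Measure.restrict_mono (prod_mono Subset.rfl hBρ₁) le_rfl)
  have hmain := ae_prod_enorm_le_of_ae_ae hW hslice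
  rw [← hprodρ] at hmain
  filter_upwards [hmain] with q hq
  refine hq.trans ?_
  rw [hCe]
  calc A₀ * K + CdG * S ≤ (A₀ + CdG) * K + (A₀ + CdG) * S :=
        add_le_add (mul_le_mul' le_self_add le_rfl) (mul_le_mul' le_add_self le_rfl)
    _ = (A₀ + CdG) * (K + S) := by ring

end MainTop


end RepDeriv

end Literature.Analysis.FluidPDE

end
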